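import Summits.FinalStateConjecture.FinalStateConjecture.Theorems.PhotonSphereChannelsChannelsResolveTameDevelopmentsRSchwarzschildRadialForm
import Summits.FinalStateConjecture.FinalStateConjecture.Theorems.PhotonSphereChannelsChannelsResolveTameDevelopmentsRSchwarzschildClockProfile
import HarnessLib

/-!
# Route PhotonSphereChannels · crux `ChannelsResolveTameDevelopmentsR` (K2R-T2, stmt-FinalStateConjecture-17430) —
# the SCHWARZSCHILD END, IV-e: the Schwarzschild metric in radial-clock coordinates as a GLOBAL smooth field on `E4`
# with bounded derivatives (the field whose affine pull-backs are the tame-ball deviations)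

Given the clock rate `ψ = F'` (file IV-a: smooth, `ψ = 0` beyond `R_b`), the components of `g_{M,0}` in the clock
coordinates `(t* + F(r), x⃗)` are the radial form with profiles `(2M/r, μ/r, κ/r²)`, `μ = s² + ψ(1 − s²)`,
`κ = s²(1 − ψ)² − ψ²`, `s² = 2M/r` (file IV-b). Multiplying the three profiles by a cutoff `χ₀(r)` (`0` below `r₁/4`,
`1` above `r₁/2`) yields a field `G` on ALL of `E4` which is

* `C^∞` and static (file IV-b), equal to `g_{M,0}` beyond `R_b` (there `ψ = 0`, `χ₀ = 1`: the Kerr–Schild radial form),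
* equal to the clock pull-back `g_{M,0}(P ·, P ·)` at every point with `‖x⃗‖ ≥ r₁/2` (where `χ₀ = 1`), and
* has globally bounded derivatives of every order (`Schw.norm_iteratedFDeriv_le_of_radial`).

`Schw.exists_clockMetric` packages this as an existence statement (no definitions).
References: K. Martel, E. Poisson, Am. J. Phys. 69 (2001) 476, §II [MartelPoisson2001]; R. P. Kerr, A. Schild (1965), §3
[KerrSchild1965].
-/

noncomputable section
set_option maxSynthPendingDepth 3 -- nested operator types `E4 →L E4 →L E4 →L ℝ` (as in the tree files)
set_option linter.dupNamespace false -- `Summit.FinalStateConjecture.FinalStateConjecture.…` is the tree's layout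

open TopologicalSpace Filter Topology Set Function Metric
open scoped ContDiff Topology InnerProductSpace

namespace Summit.FinalStateConjecture.FinalStateConjecture.Theorems.TameHull.Schw

open Literature.Geometry.Lorentzian Schwarzschild

/-- **The Schwarzschild metric in radial-clock coordinates, as a global smooth field.** For `0 < M`, `0 < r₁`,
`r₁/2 < R_b` and a smooth rate `ψ` vanishing on `[R_b, ∞)` there is `G : E4 → (E4 →L E4 →L ℝ)` which is `C^∞`, static,
equal to the Kerr–Schild components `g_{M,0}` wherever `‖x⃗‖ > R_b`, equal to the radial form with profiles
`(2M/r, (2M/r + ψ(1 − 2M/r))/r, ((2M/r)(1 − ψ)² − ψ²)/r²)` wherever `‖x⃗‖ ≥ r₁/2`, and has bounded derivatives of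
every order on all of `E4`. [cite: MartelPoisson2001, §II] -/
theorem exists_clockMetric : ∀ (M r₁ Rb : ℝ), 0 < r₁ → r₁ / 2 < Rb → ∀ {ψ : ℝ → ℝ}, ContDiff ℝ ∞ ψ → (∀ r, Rb ≤ r → ψ r = 0) → ∃ G : E4 → E4 →L[ℝ] E4 →L[ℝ] ℝ, ContDiff ℝ ∞ G ∧ (∀ (x : E4) (s : ℝ), G (x + s • E4.basisVector 0) = G x) ∧ (∀ x, Rb < E4.spatialNorm x → G x = Kerr.bilin M 0 x) ∧ (∀ x, r₁ / 2 ≤ E4.spatialNorm x → ∀ u w : E4, G x u w = Minkowski.bilin u w + 2 * M / E4.spatialNorm x * (u 0 * w 0) + (2 * M / E4.spatialNorm x + ψ (E4.spatialNorm x) * (1 - 2 * M / E4.spatialNorm x)) / E4.spatialNorm x * (u 0 * sdot x w + sdot x u * w 0) + (2 * M / E4.spatialNorm x * (1 - ψ (E4.spatialNorm x)) ^ 2 - ψ (E4.spatialNorm x) ^ 2) / E4.spatialNorm x ^ 2 * (sdot x u * sdot x w)) ∧ ∀ m : ℕ, ∃ C : ℝ, ∀ x, ‖iteratedFDeriv ℝ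 m G x‖ ≤ C := by
  intro M r₁ Rb hr₁ hRb ψ hψ hψ0
  -- the axis cutoff
  obtain ⟨χ₀, hχ₀, hχ₀0, hχ₀1, -⟩ := exists_cutoff_rising (show r₁ / 4 < r₁ / 2 by linarith)
  have hε : 0 < r₁ / 4 := by linarith
  -- the three profiles, cut off at the axis
  have hsm : ∀ r, r₁ / 4 ≤ r → ContDiffAt ℝ ∞ (fun r : ℝ ↦ 2 * M / r) r := fun r hr ↦
    contDiffAt_const.div contDiffAt_id (by linarith)
  obtain ⟨ha, ha0⟩ := contDiff_cutoff_mul hχ₀ hχ₀0 hsm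
  obtain ⟨hb, hb0⟩ := contDiff_cutoff_mul hχ₀ hχ₀0 (φ := fun r ↦ (2 * M / r + ψ r * (1 - 2 * M / r)) / r)
    fun r hr ↦ (((hsm r hr).add (hψ.contDiffAt.mul (contDiffAt_const.sub (hsm r hr)))).div contDiffAt_id
      (by linarith))
  obtain ⟨hc, hc0⟩ := contDiff_cutoff_mul hχ₀ hχ₀0
    (φ := fun r ↦ (2 * M / r * (1 - ψ r) ^ 2 - ψ r ^ 2) / r ^ 2)
    fun r hr ↦ ((((hsm r hr).mul ((contDiffAt_const.sub hψ.contDiffAt).pow 2)).sub (hψ.contDiffAt.pow 2)).div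
      (contDiffAt_id.pow 2) (pow_ne_zero 2 (by show r ≠ 0; linarith)))
  set a : ℝ → ℝ := fun r ↦ χ₀ r * (2 * M / r) with ha_def
  set b : ℝ → ℝ := fun r ↦ χ₀ r * ((2 * M / r + ψ r * (1 - 2 * M / r)) / r) with hb_def
  set c : ℝ → ℝ := fun r ↦ χ₀ r * ((2 * M / r * (1 - ψ r) ^ 2 - ψ r ^ 2) / r ^ 2) with hc_def
  -- the field
  set G : E4 → E4 →L[ℝ] E4 →L[ℝ] ℝ := fun x ↦ Minkowski.bilin + a (E4.spatialNorm x) • E4.tmul (E4.dx 0) (E4.dx 0) +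
    b (E4.spatialNorm x) • (E4.tmul (E4.dx 0) (Kerr.covecSpatial (E4.spatial x)) +
      E4.tmul (Kerr.covecSpatial (E4.spatial x)) (E4.dx 0)) +
    c (E4.spatialNorm x) • E4.tmul (Kerr.covecSpatial (E4.spatial x)) (Kerr.covecSpatial (E4.spatial x)) with hGdef
  have hG : ∀ x, G x = Minkowski.bilin + a (E4.spatialNorm x) • E4.tmul (E4.dx 0) (E4.dx 0) +
      b (E4.spatialNorm x) • (E4.tmul (E4.dx 0) (Kerr.covecSpatial (E4.spatial x)) +
        E4.tmul (Kerr.covecSpatial (E4.spatial x)) (E4.dx 0)) +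
      c (E4.spatialNorm x) • E4.tmul (Kerr.covecSpatial (E4.spatial x)) (Kerr.covecSpatial (E4.spatial x)) :=
    fun _ ↦ rfl
  have hGs : ContDiff ℝ ∞ G := contDiff_radialForm hG (contDiff_comp_spatialNorm ha hε ha0)
    (contDiff_comp_spatialNorm hb hε hb0) (contDiff_comp_spatialNorm hc hε hc0)
  have hstat : ∀ (x : E4) (s : ℝ), G (x + s • E4.basisVector 0) = G x := fun x s ↦ (radialForm_static hG x s).2
  -- on `{‖x⃗‖ ≥ r₁/2}` the cutoff is `1`
  have hmid : ∀ x, r₁ / 2 ≤ E4.spatialNorm x → ∀ u w : E4, G x u w =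
      Minkowski.bilin u w + 2 * M / E4.spatialNorm x * (u 0 * w 0) +
        (2 * M / E4.spatialNorm x + ψ (E4.spatialNorm x) * (1 - 2 * M / E4.spatialNorm x)) / E4.spatialNorm x *
          (u 0 * sdot x w + sdot x u * w 0) +
        (2 * M / E4.spatialNorm x * (1 - ψ (E4.spatialNorm x)) ^ 2 - ψ (E4.spatialNorm x) ^ 2) /
          E4.spatialNorm x ^ 2 * (sdot x u * sdot x w) := by
    intro x hx u w
    rw [radialForm_apply hG]
    simp only [ha_def, hb_def, hc_def, hχ₀1 _ hx, one_mul]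
  -- beyond `R_b` it is the Kerr–Schild form
  have hfar : ∀ x, Rb < E4.spatialNorm x → G x = Kerr.bilin M 0 x := by
    intro x hx
    have hx1 : r₁ / 2 ≤ E4.spatialNorm x := by linarith
    have hx0 : E4.spatialNorm x ≠ 0 := by linarith
    ext u w
    rw [hmid x hx1 u w, bilin_zero_apply_radial M hx0 u w, hψ0 _ hx.le]
    simp only [zero_mul, add_zero, sub_zero, one_pow, mul_one, zero_pow (two_ne_zero), sub_zero]
    field_simp
  exact ⟨G, hGs, hstat, hfar, hmid, fun m ↦ norm_iteratedFDeriv_le_of_radial hGs hstat hfar m⟩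

end Summit.FinalStateConjecture.FinalStateConjecture.Theorems.TameHull.Schw

end
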